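import Summits.BirchSwinnertonDyer.BirchSwinnertonDyer.Theorems.RamifiedHeegnerPairLeafSigmaStarTopLayer
import Literature.NumberTheory.DiophantineGeometry.KodairaSymbolUnramifiedBaseChange
import HarnessLib

/-!
# Route `RamifiedHeegnerPair`, crux U₁ `LeafRankOneUpperAtThree` (stmt-BirchSwinnertonDyer-26022) — line `tamecubic`
# (crux-ideate seat 2, round 1, gen 3; UNREGISTERED skeleton of the idea node `Ideas/tamecubic.md`, card `Lines/tamecubic.md`)

LEVER (one sentence). GENUS THEORY OVER THE TAME CUBIC THICKENING: on a residue row with a principal-series carrier `q ≡ 1 (mod 3)`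
(Kodaira IV/IV*, `c_q = 3`, `q` split in the Heegner field `K`), pass to the cubic layer `k₀ ⊂ K[q]` of the ring class field of
conductor `q` (an `S₃`-sextic over `ℚ`, totally ramified of index `3` at `w, w̄ ∣ q`): there `E` acquires GOOD reduction at `q`
(`c_W(E/k₀) = 1`), the CM points of conductor `n·q` on `X₀(N)` trace down to `−σ·y(n)` EXACTLY (`a_q = 0`), and the carrier's lost
factor `3` reappears as forced `C₃`-Tate cohomology of `E(k₀K[n]) ⊕ Ш` (local norm indices `3·3` at `w, w̄` and `3·3` at the INERT second
carrier, Chevalley/Brau/Česnavičius genus formula) — a GLOBAL Galois-module invariant over `ℤ₃[C₃]`, not a local condition at the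
carrier (which the stringent framework cannot see: every Kolyvagin class is already locally zero at an additive carrier).

HONEST FRAMING. Nothing is asserted: `sorry` only inside `stub_*`; the composition `LeafRankOneUpperAtThree_of` is kernel-checked and
concludes the crux BY NAME through the v15 socket
`LeafShimuraInert.leafRankOneUpperAtThree_of_pubManin_of_namedFactsTwo_of_shimuraFactsSplitGen_of_sigmaStarTopLayerOffSavingRows_of_lowerRankZero`.
The registered skeleton of record stays `splitkolyvagin` v15 / the lead's pick; this file is NOT registered (ideator seat). BSD is proved for
no curve; typed ≠ proved; instrument words of record: CONSISTENT ∕ VALID-direction only.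

THE CUT (6 stubs; Σ★⁸ = the registered research stub `stub_leafSigmaStarTopLayerDivisibilityAtThreeOptimalOffSavingRows` of v15):
* PRINT  `stub_printFactsU1`            = PUB⁺ (item 27491) ∧ FACTS″ ∧ SHIMURA-FACTS-GEN, by name (v15's three print stubs, conjoined).
* NEW L1 `stub_tameCubicCure`           = Tate's algorithm under TAME ramified cubic base change: types IV, IV* become I₀ (ATTACKABLE; print).
* NEW L2 `stub_carrierTraceRelation`    = the vertical distribution relation at a carrier `q ∣ N`, `a_q = 0`:
                                          `Tr_{K[nq]/K[n]} y(nq) = −σ·y(n)` in `E(ℂ)` (ATTACKABLE; CM reciprocity + `U_q f = a_q f = 0`).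
* NEW T  `stub_thickenedTopLayerOnTameRows` = L1 → L2 → Σ★⁸ restricted to rows WITH a tame-cubic carrier (UNDECIDED; the research:
                                          `ℤ₃[C₃]`-equivariant Kolyvagin–Jetchev over `k₀` + genus theory; card §Stubs B3–B5).
* RESIDUAL `stub_topLayerOffTameRows`   = Σ★⁸ restricted to rows WITHOUT one (the 19 SC-only rows; IDEA-NEEDED — other lines' habitat).
* MEMBER `stub_gss2LowerAtThreeRankZero` = route item 26023 by name.
Composition: Σ★⁸ from T ∘ (L1, L2) on tame rows and from the residual stub off them (`by_cases`), then the v15 socket.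

References: [cite: Jetchev2008, Thm. 1.4 (ii), Conj. 1.3] [cite: GrossLMS1991, §3 (x_n, distribution relation), §4 (4.1)]
[cite: SilvermanATAEC1994, IV.9.4 Table 4.1, Steps 5 and 8] [cite: SilvermanAEC2009, Prop. VII.5.4] [cite: MazurRubin2007, local constants δ_v]
[cite: Brau2014, Thm. 1.2 (arXiv:1401.3304)] [cite: Cesnavicius2017, p-Selmer growth in extensions of degree p (arXiv:1408.1151)]
[cite: BertoliniDarmon1990, Kolyvagin's descent and Mordell–Weil groups over ring class fields] [cite: Cox2013, Thm. 11.1, §11.D (Shimura reciprocity)]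
-/

set_option linter.dupNamespace false -- D-0017: the summit = problem namespace repeats by design
set_option autoImplicit false

noncomputable section

open scoped Classical NumberField

namespace Summit.BirchSwinnertonDyer.BirchSwinnertonDyer.Cruxes.LeafRankOneUpperAtThree.Tamecubic

open WeierstrassCurve NumberField IsDedekindDomain CongruenceSubgroup Literature Literature.NumberTheory.EllipticCurves
  Literature.NumberTheory.EllipticCurves.ModularForms
  Literature.NumberTheory.EllipticCurves.Rank1Residual
  Literature.NumberTheory.DiophantineGeometry
  Literature.NumberTheory.Automorphic
  Summit.BirchSwinnertonDyer.Rank1Residual.Additive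
  Summit.BirchSwinnertonDyer.Rank1Residual.X11b.Three
  Summit.BirchSwinnertonDyer.BirchSwinnertonDyer.Theses.RamifiedHeegnerPair
  Summit.BirchSwinnertonDyer.BirchSwinnertonDyer.Theorems

/-! ## The new objects -/

/-- **A tame-cubic (principal-series) carrier of `W` at level `N`**: a prime `q ∣ N` with `q ≡ 1 (mod 3)`, `3 ∣ c_q(W/ℚ_q)` and `W` not
multiplicative at `q` — equivalently Kodaira type IV or IV* with rational components at a prime where `μ₃ ⊂ ℚ_q`, so that
`Gal(K[nq]/K[n]) ≅ 𝔽_q^×` has a cubic quotient (the thickening direction). The 14 PS rows of the residue census have one. [this line] -/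
def HasTameCubicCarrier (W : WeierstrassCurve ℚ) (N : ℕ) : Prop :=
  ∃ (q : ℕ) (_ : Fact q.Prime), q ∣ N ∧ 3 ∣ q - 1 ∧
    3 ∣ (W.baseChange ℚ_[q]).localTamagawaNumber ℤ_[q] ∧ ¬ W.HasMultiplicativeReductionAtPrime q

/-- **L1 — the tame cubic cure** (Tate's algorithm under tame totally ramified base change of index `3`): in the Dedekind frame of the
tree's unramified fact `kodairaSymbolAt_baseChange_of_ramificationIdx_eq_one` (`A ⊆ B`, fraction fields `K ⊆ L`, `w ∣ v`), if the residue
characteristic of `v` is prime to `6`, the ramification index is exactly `3` (`vB ≤ w³`, `vB ≰ w⁴`) and `W` has Kodaira type IV or IV* at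
`v` (`ord_v Δ_min ∈ {4, 8}`, semistability defect `e = 3`), then `W ⁄ L` has GOOD reduction at `w` (`3·ord_v Δ ≡ 0 mod 12`).
Silverman ATAEC IV.9.4 (Table 4.1) with AEC VII.5.4 and App. C §16 (`12 ∕ gcd(12, ord_v Δ)`); Liu 10.2. ATTACKABLE (print; elementary).
[cite: SilvermanATAEC1994, IV.9.4 Table 4.1] [cite: SilvermanAEC2009, Prop. VII.5.4 (c)] -/
def TameCubicCure : Prop :=
  ∀ (A : Type) [CommRing A] [IsDedekindDomain A] (K : Type) [Field K] [Algebra A K] [IsFractionRing A K]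
    (B : Type) [CommRing B] [IsDedekindDomain B] (L : Type) [Field L] [Algebra B L] [IsFractionRing B L]
    [Algebra A B] [Algebra K L] [Module.Finite A B]
    (v : HeightOneSpectrum A) (w : HeightOneSpectrum B) (W : WeierstrassCurve K) [W.IsElliptic]
    [PerfectField (IsLocalRing.ResidueField (v.adicCompletionIntegers K))]
    [PerfectField (IsLocalRing.ResidueField (w.adicCompletionIntegers L))],
    (algebraMap K L).comp (algebraMap A K) = (algebraMap B L).comp (algebraMap A B) →
    w.asIdeal.under A = v.asIdeal →
    (6 : A) ∉ v.asIdeal →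
    v.asIdeal.map (algebraMap A B) ≤ w.asIdeal ^ 3 → ¬ v.asIdeal.map (algebraMap A B) ≤ w.asIdeal ^ 4 →
    (W.kodairaSymbolAt v = KodairaSymbol.IV ∨ W.kodairaSymbolAt v = KodairaSymbol.IVstar) →
    (W.baseChange L).kodairaSymbolAt w = KodairaSymbol.I 0

/-- **L2 — the vertical distribution relation at a carrier** (`q ∣ N` additive, so `a_q(f) = 0` as `q² ∣ N`; `q ∤ n`, `n` prime to `N`):
the `q + 1` superlattices of index `q` of the CM lattice `Λ_n` of `x(n)` are the `q − 1` Galois conjugates of `Λ_{nq}` (conductor `nq`)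
and the two `𝒪_n`-stable ones `𝔴⁻¹Λ_n`, `𝔴̄⁻¹Λ_n`; `U_q·x(n)` sums over all but `𝔴⁻¹Λ_n` (the level-structure direction), level
structures match by an index count, and `φ ∘ U_q = a_q·φ = 0` on the newform's parametrisation. Hence, in `E(ℂ)`:
`Σ_{g ∈ Gal(K[nq]/K[n])} g·y(nq) = −σ·y(n)` for some `σ ∈ Gal(K[n]/K)` (the Artin symbol of `𝔴̄ ∩ 𝒪_n`). Typed over the tree's
`KolyvaginHeegnerData` (no coprimality field, so level `n·q` with `q ∣ N` is available; `y(nq) ∈ E(K[nq])` by Shimura reciprocity, the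
pair of lattices being `Ô_{nq}^×`-stable); hypothesis `#𝒪_K^× = 2` (`torsionOrder K = 2`) because for `K = ℚ(i), ℚ(√−3)` and `n = 1`
the `U_q`-sum counts each conjugate `u_K/2` times (the `u_m` of Cai–Chen–Liu Thm. 2.13). ATTACKABLE (CM reciprocity reading + Hecke algebra; Gross 1991 §3 pattern at `q ∣ N`).
[cite: GrossLMS1991, §3 (distribution relation), proof pattern] [cite: Cox2013, Thm. 11.1, §11.D] -/
def CarrierTraceRelation : Prop :=
  ∀ (N : ℕ) [NeZero N] (W : WeierstrassCurve ℚ) [W.IsElliptic] (K : Type) [Field K] [NumberField K]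
    (Dt : ModularParametrizationData W N) (β : ℤ) (ι : K →+* ℂ) (q n : ℕ) [Fact q.Prime]
    (dq : KolyvaginHeegnerData Dt β ι (n * q)) (dn : KolyvaginHeegnerData Dt β ι n),
    IsImaginaryQuadratic K → (NumberField.Units.torsionOrder K : ℕ) = 2 → q ∣ N → n.Coprime N →
    ¬ W.HasGoodReductionAtPrime q → ¬ W.HasMultiplicativeReductionAtPrime q →
    ∃ T : Finset (ringClassField K ι (n * q) ≃ₐ[ℚ] ringClassField K ι (n * q)),
      (∀ g, g ∈ T ↔ g ∈ ringClassGalOver ι (n * q) n) ∧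
      ∃ σ ∈ ringClassGal ι n,
        ∑ g ∈ T, WeierstrassCurve.Affine.Point.map (ringClassField K ι (n * q)).subtype.toRatAlgHom
            (pointGalHom W (ringClassField K ι (n * q)) g dq.y) =
          - WeierstrassCurve.Affine.Point.map (ringClassField K ι n).subtype.toRatAlgHom
            (pointGalHom W (ringClassField K ι n) σ dn.y)

/-- **Σ★⁸ with a row predicate inserted**: the registered top-layer stub's signature (v15, verbatim) with one more hypothesis `X W N`
right after `W.conductorNorm ℤ = N`. `TopLayerOn HasTameCubicCarrier` = the PS habitat; `TopLayerOn (¬ HasTameCubicCarrier · ·)` = the rest. -/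
def TopLayerOn (X : WeierstrassCurve ℚ → ℕ → Prop) : Prop :=
  ∀ (W : WeierstrassCurve ℚ) [W.IsElliptic] [W.IsGloballyMinimal] (N : ℕ) [NeZero N]
      (K : Type) [Field K] [NumberField K]
      (Dt : ModularParametrizationData W N) (H : HeegnerDatum N (NumberField.discr K)) (ι : K →+* ℂ)
      (P : (W.baseChange K).toAffine.Point),
      ¬ W.HasCM → Addv W 3 → SubGss W 3 → W.conductorNorm ℤ = N → X W N →
      (∀ z ∈ Dt.L.lattice, ∃ w ∈ periodLattice Dt.f, z = Dt.c * w) →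
      ¬ (∃ (q : ℕ) (_ : Fact q.Prime), q ∣ N ∧
          padicValNat 3 W.tamagawaProduct ≤ padicValNat 3 ((W.baseChange ℚ_[q]).localTamagawaNumber ℤ_[q])) →
      ¬ ((∀ (q : ℕ) [Fact q.Prime], 3 ∣ (W.baseChange ℚ_[q]).localTamagawaNumber ℤ_[q] →
            W.HasSplitMultiplicativeReductionAtPrime q) ∧
          ∃ S : Finset ℕ, Even S.card ∧ (∀ ℓ ∈ S, ∃ _ : Fact ℓ.Prime, W.HasMultiplicativeReductionAtPrime ℓ) ∧
            (∀ (ℓ : ℕ) [Fact ℓ.Prime], ℓ ∉ S → W.HasSplitMultiplicativeReductionAtPrime ℓ →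
              ¬ 3 ∣ padicValInt ℓ W.minimalDiscriminantInt) ∧
            ((∃ ℓ₀ ∈ S, ¬ 3 ∣ padicValInt ℓ₀ W.minimalDiscriminantInt) ∨
              (∃ ℓ₀ t : ℕ, ∃ _ : Fact ℓ₀.Prime, ∃ _ : Fact t.Prime,
                W.HasMultiplicativeReductionAtPrime ℓ₀ ∧ W.HasMultiplicativeReductionAtPrime t ∧
                ℓ₀ ∉ S ∧ t ∉ S ∧ t ≠ ℓ₀ ∧ ¬ 3 ∣ padicValInt ℓ₀ W.minimalDiscriminantInt) ∨
              (∃ R : Finset ℕ, R ⊆ S ∧ 2 * R.card = S.card ∧ ∀ q ∈ R, q = 2 ∨ ¬ 3 ∣ q - 1))) →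
      ¬ (Surj W 3 ∧ ∃ (q₁ : ℕ) (_ : Fact q₁.Prime), ¬ W.HasGoodReductionAtPrime q₁ ∧
          (∀ (q : ℕ) [Fact q.Prime], q ≠ q₁ → 3 ∣ (W.baseChange ℚ_[q]).localTamagawaNumber ℤ_[q] →
            W.HasSplitMultiplicativeReductionAtPrime q) ∧
          ∃ S : Finset ℕ, Even S.card ∧ q₁ ∉ S ∧
            (∀ ℓ ∈ S, ∃ _ : Fact ℓ.Prime, W.HasMultiplicativeReductionAtPrime ℓ) ∧
            (∀ (ℓ : ℕ) [Fact ℓ.Prime], ℓ ∉ S → ℓ ≠ q₁ → W.HasSplitMultiplicativeReductionAtPrime ℓ →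
              ¬ 3 ∣ padicValInt ℓ W.minimalDiscriminantInt) ∧
            ((∃ ℓ₀ ∈ S, ¬ 3 ∣ padicValInt ℓ₀ W.minimalDiscriminantInt) ∨
              (∃ ℓ₀ t : ℕ, ∃ _ : Fact ℓ₀.Prime, ∃ _ : Fact t.Prime,
                W.HasMultiplicativeReductionAtPrime ℓ₀ ∧ W.HasMultiplicativeReductionAtPrime t ∧
                ℓ₀ ∉ S ∧ t ∉ S ∧ t ≠ ℓ₀ ∧ ¬ 3 ∣ padicValInt ℓ₀ W.minimalDiscriminantInt) ∨
              (∃ R : Finset ℕ, R ⊆ S ∧ 2 * R.card = S.card ∧ ∀ q ∈ R, q = 2 ∨ ¬ 3 ∣ q - 1))) →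
      IsImaginaryQuadratic K → SatisfiesHeegnerHypothesis N K →
      (WeierstrassCurve.Affine.Point.map ι.toRatAlgHom) P = heegnerPointComplex Dt H →
      ¬ IsOfFinAddOrder P → Odd (NumberField.discr K) →
      ∀ (s' : ℕ), s' ≤ padicValNat 3 W.tamagawaProduct + padicValNat 3 Dt.c.natAbs →
      ∀ (n : ℕ) (d : KolyvaginHeegnerData Dt H.β ι n), Squarefree n →
      (∀ ℓ ∈ n.primeFactors, Zhang2014.IsKolyvaginPrime N W K 3 ℓ ∧ s' ≤ Zhang2014.kolyvaginIndex W 3 ℓ) →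
      (∀ (q : ℕ) [Fact q.Prime], q ∣ N → padicValNat 3 ((W.baseChange ℚ_[q]).localTamagawaNumber ℤ_[q]) < s') →
      Koly.PDiv d 3 s'

/-! ## The stubs -/

/-- STUB PRINT (never progress) = v15's `stub_publishedInputsU1Manin` ∧ `stub_heegnerReadingNamedFactsTwo` ∧ `stub_shimuraRoadNamedFactsGen`,
by name: route item 27491 PUB⁺, the two named facts F1 ∧ F3 of the any-carrier reading, the four cite-only facts of the flag-free saving road.
[cite: GrossZagier1986, Thm. I.(6.3)] [cite: GrossLMS1991, Prop. 3.7 (2), §6] [cite: PastenShimura2024, Prop. 6.13] [cite: FriedbergHoffstein1995, Thm. B] -/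
theorem stub_printFactsU1 :
    Summit.BirchSwinnertonDyer.BirchSwinnertonDyer.Theses.RamifiedHeegnerPair.LeafRankOnePrintedInputsAtThree ∧
    (Literature.NumberTheory.EllipticCurves.GrossLMS1991.prop37_2_frobeniusCongruence ∧
      Literature.NumberTheory.EllipticCurves.Gross1991_heegnerPoint_sub_ratTorsion_mem_E0_imageFree) ∧
    (Literature.NumberTheory.Automorphic.nonempty_shimuraParametrizationData ∧
      Literature.NumberTheory.Automorphic.PastenShimura2024_componentOrders ∧
      Literature.NumberTheory.EllipticCurves.friedbergHoffstein_exists_twist_ne_zero_inertAt_splitAt ∧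
      Literature.NumberTheory.EllipticCurves.shimuraCurve_heegnerSystem_primitivesSplitReduced) := by
  sorry

/-- STUB L1 (NEW, ATTACKABLE, print): the tame cubic cure `TameCubicCure`. [cite: SilvermanATAEC1994, IV.9.4 Table 4.1] -/
theorem stub_tameCubicCure : TameCubicCure := by
  sorry

/-- STUB L2 (NEW, ATTACKABLE, CM-reciprocity reading): the vertical distribution relation `CarrierTraceRelation`.
[cite: GrossLMS1991, §3] [cite: Cox2013, Thm. 11.1] -/
theorem stub_carrierTraceRelation : CarrierTraceRelation := by
  sorry

/-- STUB T (NEW, UNDECIDED — the research): **the thickened top layer on the tame rows**. Given the cure (L1) and the vertical trace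
relation (L2), Σ★⁸ holds on every row with a tame-cubic carrier `q`. Intended proof (card §Stubs B3–B5): choose the Heegner field `K`
(Friedberg–Hoffstein supply) with `3 ∤ h_K` and the second carrier's places INERT in the cubic layer `k₀ ⊂ K[q]`; run Kolyvagin–Jetchev
`ℤ₃[C₃]`-equivariantly over `k₀` on the thickened system `y♯(n) := Tr_{K[nq]/k₀K[n]} y(nq)` (Jetchev is SHARP there: the only paying
carrier of `E/k₀` is the inert one, `max = Σ = t′`), and read the cured carrier's factor `3` from the genus formula (local norm indices
`3, 3` at `w, w̄ ∣ q` and `3, 3` at the inert carrier force `Ĥ⁰(C₃, E(k₀K[n]) ⊕ Ш) ≠ 0`), then descend by `P_n = −σ⁻¹·N_{C₃} P♯_n` (L2).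
Why it might fail: the `C₃`-cohomology may sit in Ш(E/k₀K[n]) rather than in the `P_n`-line (then the gain must come through the
equivariant Ш-bound — unproved at `p = #G`); joint supply «`L′(E/K,1) ≠ 0` ∧ inertness of `q′` in `k₀`» is a non-congruence condition on `K`.
[cite: Jetchev2008, Thm. 1.4 (ii)] [cite: Brau2014, Thm. 1.2] [cite: BertoliniDarmon1990, main theorem] -/
theorem stub_thickenedTopLayerOnTameRows :
    TameCubicCure → CarrierTraceRelation → TopLayerOn HasTameCubicCarrier := by
  sorry

/-- STUB RESIDUAL (IDEA-NEEDED; not this line's habitat): Σ★⁸ on the rows with NO tame-cubic carrier (the 19 SC-only rows of the census: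
additive carriers `2` or `≡ 2 (mod 3)`, where `Gal(K[q^k]/K[1])` has no `3`-part for `q` split). Other lines (`nscartan`, `definitesum`,
`katoprhalf`) or Σ★⁸ itself. [cite: Jetchev2008, Conj. 1.3] -/
theorem stub_topLayerOffTameRows : TopLayerOn (fun W N ↦ ¬ HasTameCubicCarrier W N) := by
  sorry

/-- STUB MEMBER = route item 26023 `Gss2LowerAtThreeRankZero` by name. [cite: Jetchev2008, Conj. 1.3] -/
theorem stub_gss2LowerAtThreeRankZero :
    Summit.BirchSwinnertonDyer.BirchSwinnertonDyer.Theses.RamifiedHeegnerPair.Gss2LowerAtThreeRankZero := by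
  sorry

/-! ## The composition (kernel-checked; no `sorry` below this line) -/

/-- Σ★⁸ (v15's registered research stub, verbatim) from the two row-halves. Pure logic (`by_cases` on the row predicate). -/
theorem sigmaStarTopLayer_of_halves (hOn : TopLayerOn HasTameCubicCarrier)
    (hOff : TopLayerOn (fun W N ↦ ¬ HasTameCubicCarrier W N)) : TopLayerOn (fun _ _ ↦ True) := by
  intro W _ _ N _ K _ _ Dt H ι P hCM hadd hG hN _ hlat hmono hSh hSav hK hHN hP hnt hodd s' hs' n d hn hℓ htop
  by_cases h : HasTameCubicCarrier W N
  · exact hOn W N K Dt H ι P hCM hadd hG hN h hlat hmono hSh hSav hK hHN hP hnt hodd s' hs' n d hn hℓ htop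
  · exact hOff W N K Dt H ι P hCM hadd hG hN h hlat hmono hSh hSav hK hHN hP hnt hodd s' hs' n d hn hℓ htop

/-- **The crux BY NAME from the six stubs' statements.** -/
theorem LeafRankOneUpperAtThree_of
    (hprint : Summit.BirchSwinnertonDyer.BirchSwinnertonDyer.Theses.RamifiedHeegnerPair.LeafRankOnePrintedInputsAtThree ∧
      (Literature.NumberTheory.EllipticCurves.GrossLMS1991.prop37_2_frobeniusCongruence ∧
        Literature.NumberTheory.EllipticCurves.Gross1991_heegnerPoint_sub_ratTorsion_mem_E0_imageFree) ∧
      (Literature.NumberTheory.Automorphic.nonempty_shimuraParametrizationData ∧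
        Literature.NumberTheory.Automorphic.PastenShimura2024_componentOrders ∧
        Literature.NumberTheory.EllipticCurves.friedbergHoffstein_exists_twist_ne_zero_inertAt_splitAt ∧
        Literature.NumberTheory.EllipticCurves.shimuraCurve_heegnerSystem_primitivesSplitReduced))
    (hL1 : TameCubicCure) (hL2 : CarrierTraceRelation)
    (hT : TameCubicCure → CarrierTraceRelation → TopLayerOn HasTameCubicCarrier)
    (hOff : TopLayerOn (fun W N ↦ ¬ HasTameCubicCarrier W N))
    (hL0 : Summit.BirchSwinnertonDyer.BirchSwinnertonDyer.Theses.RamifiedHeegnerPair.Gss2LowerAtThreeRankZero) :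
    Summit.BirchSwinnertonDyer.BirchSwinnertonDyer.Theses.RamifiedHeegnerPair.LeafRankOneUpperAtThree := by
  obtain ⟨hpub, hNF, hSF⟩ := hprint
  have hStar := sigmaStarTopLayer_of_halves (hT hL1 hL2) hOff
  exact LeafShimuraInert.leafRankOneUpperAtThree_of_pubManin_of_namedFactsTwo_of_shimuraFactsSplitGen_of_sigmaStarTopLayerOffSavingRows_of_lowerRankZero
    hpub hNF.1 hNF.2 hSF.1 hSF.2.1 hSF.2.2.1 hSF.2.2.2
    (fun W _ _ N _ K _ _ Dt H ι P hCM hadd hG hN hlat hmono hSh hSav hK hHN hP hnt hodd s' hs' n d hn hℓ htop ↦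
      hStar W N K Dt H ι P hCM hadd hG hN trivial hlat hmono hSh hSav hK hHN hP hnt hodd s' hs' n d hn hℓ htop)
    hL0

/-- The crux from the (sorried) stubs — shows the skeleton is complete. -/
theorem LeafRankOneUpperAtThree_holds_of_stubs :
    Summit.BirchSwinnertonDyer.BirchSwinnertonDyer.Theses.RamifiedHeegnerPair.LeafRankOneUpperAtThree :=
  LeafRankOneUpperAtThree_of stub_printFactsU1 stub_tameCubicCure stub_carrierTraceRelation
    stub_thickenedTopLayerOnTameRows stub_topLayerOffTameRows stub_gss2LowerAtThreeRankZero

end Summit.BirchSwinnertonDyer.BirchSwinnertonDyer.Cruxes.LeafRankOneUpperAtThree.Tamecubic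

end
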